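import Literature.Computability.Complexity.GateEliminationWires
import Literature.Computability.Complexity.GateEliminationCases24
import Literature.Computability.Complexity.GateEliminationCase3
import Literature.Computability.Complexity.GateEliminationSubstVar
import Literature.Computability.Complexity.GateEliminationAssignLin

/-!
# Gate elimination: troubled pair elimination (Li–Yang Lemma 3.12)

"Let `C` be a circuit computing `f|_R` … Let `𝒫` be a non-empty packing of `C`. Assume that `f`
is not trivial under two substitutions. Then it is possible to perform substitutions such that
complexity measure decrement per substitution is at least `δ_P = min{3α_I/2, 3 - 3α_φ + α_I + α_Q}`"
(ECCC TR21-023, Lemma 3.12) — here for any two distinct adjacent troubled gates `G₁, G₂`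
(a *troubled pair*, Def. 3.2), packed or not, with the conclusion in the form needed by the
one-step claim (`StepBranch2`: `Δμ ≥ δ t`, using `δ ≤ 4α_I/3 ≤ δ_P` and `δ ≤ 2 - 2α_φ + α_I + α_Q`).

The printed proof: a protected variable of the pair is Case 1 (`case1_and_gate`); otherwise,
for a non-compact pair (inner variable `y`, boundary variables `x`, `z`) the constant
substitutions to `x` and `z` trivializing `G₁` and `G₂` make `x, y, z` non-influential
(`Δμ ≥ 3α_I`, `t = 2`); for a compact pair (both gates read `x` and `y`) "either a constant
substitution (to `x` or `y`) or an affine substitution `y ← x ⊕ b` will trivialize both gates. We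
then replace `G₁` and `G₂` by constants such that `x` and `y` becomes non-influential. Hence
`Δμ ≥ 2α_I`", `t = 1`.

## References

* J. Li, T. Yang, *3.1n − o(n) circuit lower bounds for explicit functions*, STOC 2022;
  ECCC TR21-023, Def. 3.1–3.3, Lemma 3.12, §4.1 (Case 0.4).
-/

namespace Literature.Computability.Complexity

open Finset

namespace Semicircuit

variable {n : ℕ}

/-! ### Generalities -/

/-- The two wires of a troubled gate: two distinct `2`-variables at the two positions.
[cite: LiYang2022, Def. 3.1] -/
theorem Troubled.exists_wires {D : Semicircuit n} {G : Fin D.m} (h : D.Troubled G) :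
    IsAndOp (D.op G) ∧ D.fanout (.gate G) = 1 ∧ ∃ (x y : Fin n) (p : Fin 2), x ≠ y ∧
      D.arg G p = .var x ∧ D.arg G p.rev = .var y ∧ D.fanout (.var x) = 2 ∧ D.fanout (.var y) = 2 := by
  obtain ⟨hand, h1, x, y, hxy, hr, hx, hy⟩ := h
  refine ⟨hand, h1, x, y, ?_⟩
  have hx' : Node.var x ∈ Set.range (D.arg G) := by rw [hr]; exact Set.mem_insert _ _
  have hy' : Node.var y ∈ Set.range (D.arg G) := by rw [hr]; exact Set.mem_insert_of_mem _ rfl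
  obtain ⟨p, hp⟩ := hx'
  obtain ⟨p', hp'⟩ := hy'
  have hpp : p' ≠ p := fun h => by rw [h, hp] at hp'; exact hxy (Node.var.inj hp')
  have : p' = p.rev := by
    obtain rfl | rfl : p = 0 ∨ p = 1 := by fin_cases p <;> simp
    all_goals obtain rfl | rfl : p' = 0 ∨ p' = 1 := by fin_cases p' <;> simp
    all_goals first | exact absurd rfl hpp | rfl
  subst this
  exact ⟨p, hxy, hp, hp', hx, hy⟩

/-- A position of a gate reading the variable `x_z` of a troubled gate, and the other variable.
[cite: LiYang2022, Def. 3.1] -/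
theorem Troubled.exists_wires_of_reads {D : Semicircuit n} {G : Fin D.m} (h : D.Troubled G) {z : Fin n}
    (hz : ∃ a, D.arg G a = .var z) :
    ∃ (p : Fin 2) (x : Fin n), x ≠ z ∧ D.arg G p = .var z ∧ D.arg G p.rev = .var x ∧
      D.fanout (.var z) = 2 ∧ D.fanout (.var x) = 2 := by
  obtain ⟨-, -, x, y, p, hxy, hx, hy, hfx, hfy⟩ := h.exists_wires
  obtain ⟨a, ha⟩ := hz
  by_cases hap : a = p
  · subst hap
    rw [hx] at ha; cases ha
    exact ⟨a, y, hxy.symm, hx, hy, hfx, hfy⟩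
  · have : a = p.rev := by
      obtain rfl | rfl : p = 0 ∨ p = 1 := by fin_cases p <;> simp
      all_goals obtain rfl | rfl : a = 0 ∨ a = 1 := by fin_cases a <;> simp
      all_goals first | exact absurd rfl hap | rfl
    subst this
    rw [hy] at ha; cases ha
    refine ⟨p.rev, x, hxy, hy, ?_, hfy, hfx⟩
    rw [Fin.rev_rev]; exact hx

/-- A `1`-gate has a reader. [folklore] -/
theorem exists_reader_of_fanout_pos {D : Semicircuit n} {v : Node n D.m} (h : 0 < D.fanout v) :
    ∃ (k : Fin D.m) (a : Fin 2), D.arg k a = v := by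
  by_contra hno
  push Not at hno
  rw [(fanout_eq_zero_iff D v).mpr hno] at h
  exact lt_irrefl _ h

/-- An ∧-type gate reading `x_z` at position `p` is trivialized by a suitable constant
substituted to `x_z`. [cite: LiYang2022, §2.1] -/
theorem exists_trivializing {D : Semicircuit n} {G : Fin D.m} (hand : IsAndOp (D.op G)) (p : Fin 2) :
    ∃ b : Bool, D.liveFn G p b false = D.liveFn G p b true := by
  obtain ⟨c₁, c₂, c₃, hop⟩ := hand
  let bG : Bool := if p = 0 then c₁ else c₂
  have hbG : bG = if p = 0 then c₁ else c₂ := rfl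
  refine ⟨bG, ?_⟩
  unfold liveFn
  obtain rfl | rfl : p = 0 ∨ p = 1 := by fin_cases p <;> simp
  · rw [if_pos rfl, if_pos rfl, hop, hop, hbG, if_pos rfl]
    cases c₁ <;> cases c₂ <;> cases c₃ <;> rfl
  · rw [if_neg (by decide), if_neg (by decide), hop, hop, hbG, if_neg (by decide)]
    cases c₁ <;> cases c₂ <;> cases c₃ <;> rfl

/-- The equation of a trivialized gate: its function ignores its inputs. [cite: LiYang2022, §3.3 (Rule 2)] -/
theorem op_eq_const_of_trivialized {D : Semicircuit n} {G : Fin D.m} {p : Fin 2} {b : Bool} (h₀ : D.arg G p = .const b)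
    (htriv : D.liveFn G p b false = D.liveFn G p b true) (x : Fin n → Bool) (w : Fin D.m → Bool) :
    D.op G (D.nodeVal x w (D.arg G 0)) (D.nodeVal x w (D.arg G 1)) = D.liveFn G p b false := by
  rw [op_eq_liveFn h₀]
  cases D.nodeVal x w (D.arg G p.rev)
  · rfl
  · exact htriv.symm

/-- **A gate whose function ignores its inputs is not the output** when the circuit computes an
affine disperser for dimension `d` on a source of dimension `≥ 2d`. [cite: LiYang2022, proof of Thm. 4.1 (§4.1)] -/
theorem out_ne_of_pointwise_const {D : Semicircuit n} {f : (Fin n → ZMod 2) → Bool} {R : RdqSource n} {d : ℕ}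
    (hf : IsAffineDisperser f d) (hd : 2 * d ≤ R.dim) (hF : D.Fair) (hC : D.ComputesRestr f R)
    {k₀ : Fin D.m} {c : Bool}
    (hid : ∀ (x : Fin n → Bool) (w : Fin D.m → Bool), D.op k₀ (D.nodeVal x w (D.arg k₀ 0)) (D.nodeVal x w (D.arg k₀ 1)) = c) :
    D.out ≠ .gate k₀ := by
  intro hout
  obtain ⟨u, hu, v, hv, huv⟩ := hf.exists_ne_of_sol R hd
  have key : ∀ u ∈ R.Sol, f u = c := by
    intro u hu
    obtain ⟨w, hw, -⟩ := hF (boolOfZMod2.symm u)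
    rw [← hC.2 u hu w hw, hout]
    show w k₀ = c
    rw [hw k₀, hid]
  exact huv ((key u hu).trans (key v hv).symm)

/-- Counting the positions of a gate wired to a node: none. [folklore] -/
theorem card_filter_arg_eq_zero {D : Semicircuit n} {G : Fin D.m} {u : Node n D.m} (h : ∀ a, D.arg G a ≠ u) :
    (univ.filter fun a : Fin 2 => D.arg G a = u).card = 0 := by
  rw [card_eq_zero, filter_eq_empty_iff]; exact fun a _ => h a

/-- Counting the positions of a gate wired to a node: exactly one. [folklore] -/
theorem card_filter_arg_eq_one {D : Semicircuit n} {G : Fin D.m} {u : Node n D.m} {p : Fin 2}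
    (hp : D.arg G p = u) (hq : D.arg G p.rev ≠ u) : (univ.filter fun a : Fin 2 => D.arg G a = u).card = 1 := by
  rw [card_eq_one]
  refine ⟨p, ?_⟩
  ext a
  simp only [mem_filter, mem_univ, true_and, mem_singleton]
  constructor
  · intro h
    by_contra hne
    have : a = p.rev := by
      obtain rfl | rfl : p = 0 ∨ p = 1 := by fin_cases p <;> simp
      all_goals obtain rfl | rfl : a = 0 ∨ a = 1 := by fin_cases a <;> simp
      all_goals first | exact absurd rfl hne | rfl
    exact hq (this ▸ h)
  · rintro rfl; exact hp

/-- Counting the positions of a gate wired to a node: both. [folklore] -/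
theorem card_filter_arg_eq_two {D : Semicircuit n} {G : Fin D.m} {u : Node n D.m} (h : ∀ a, D.arg G a = u) :
    (univ.filter fun a : Fin 2 => D.arg G a = u).card = 2 := by
  rw [filter_true_of_mem fun a _ => h a]; rfl

/-! ### Two eliminations of constant gates, tracking one variable -/

section TwoConst

variable {D : Semicircuit n} {f : (Fin n → ZMod 2) → Bool} {R : RdqSource n} {d : ℕ}
  {αφ αI : ℝ} {P : Finset (Fin D.m × Fin D.m)}

/-- **Replacing two gates with input-independent functions by constants** ("we then replace
`G₁` and `G₂` by constants such that `x` and `y` becomes non-influential", Lemma 3.12; "`G₂`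
and the only descendants of `G₁` are degenerate", trivialized gates after a constant
substitution): two distinct gates reading no gate, each with coinciding wires or a constant
wire, whose functions ignore their inputs, are eliminated one after the other (`ΔΦ ≤ 1`
each); a variable all of whose wires went into them becomes a `0`-variable, so if it is
unprotected it stops being influential:
`μ' ≤ μ - 2(1 - α_φ) - α_I`. [cite: LiYang2022, Lemma 3.12, Lemma 3.11] -/
theorem elim_two_const_gates (hf : IsAffineDisperser f d) (hd : 2 * d ≤ R.dim) (hF : D.Fair)
    (hC : D.ComputesRestr f R) (hP : D.IsPacking P) (hφ : 0 ≤ αφ) (hI : 0 ≤ αI) (αQ : ℝ)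
    {G₁ G₂ : Fin D.m} (hne : G₁ ≠ G₂) (c₁ c₂ : Bool)
    (hid₁ : ∀ (x : Fin n → Bool) (w : Fin D.m → Bool),
      D.op G₁ (D.nodeVal x w (D.arg G₁ 0)) (D.nodeVal x w (D.arg G₁ 1)) = c₁)
    (hacc₁ : D.arg G₁ 0 = D.arg G₁ 1 ∨ ∃ (a : Fin 2) (b : Bool), D.arg G₁ a = .const b)
    (hng₁ : ∀ a g, D.arg G₁ a ≠ .gate g)
    (hid₂ : ∀ (x : Fin n → Bool) (w : Fin D.m → Bool),
      D.op G₂ (D.nodeVal x w (D.arg G₂ 0)) (D.nodeVal x w (D.arg G₂ 1)) = c₂)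
    (hacc₂ : D.arg G₂ 0 = D.arg G₂ 1 ∨ ∃ (a : Fin 2) (b : Bool), D.arg G₂ a = .const b)
    (hng₂ : ∀ a g, D.arg G₂ a ≠ .gate g)
    {v : Fin n} (hvp : ¬ R.Protected v) (hvinf : v ∈ D.influential R)
    (hv : D.fanout (.var v) = (univ.filter fun a : Fin 2 => D.arg G₁ a = .var v).card +
      (univ.filter fun a : Fin 2 => D.arg G₂ a = .var v).card) :
    ∃ (D' : Semicircuit n) (P' : Finset (Fin D'.m × Fin D'.m)), D'.Fair ∧ D'.ComputesRestr f R ∧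
      D'.IsPacking P' ∧ D'.m + 2 = D.m ∧
      D'.measure αφ αI αQ P' R ≤ D.measure αφ αI αQ P R - 2 * (1 - αφ) - αI := by
  classical
  -- first elimination
  have hout₁ : D.out ≠ .gate G₁ := out_ne_of_pointwise_const hf hd hF hC hid₁
  let E₁ := elimDataWRedirectConst hF hC hP c₁ hid₁ hacc₁ (fun a => hng₁ a G₁) hout₁ hφ hI αQ
  -- `G₂` in the new circuit
  obtain ⟨k₂, hk₂⟩ := E₁.ι_surj G₂ hne.symm
  have harg₂ : ∀ a, E₁.C'.arg k₂ a = E₁.pull (D.arg G₂ a) := fun a => by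
    rw [E₁.arg_eq', hk₂, if_neg (hng₂ a G₁)]
  have hval₂ : ∀ (a : Fin 2) (x : Fin n → Bool) (w' : Fin E₁.C'.m → Bool) (w : Fin D.m → Bool),
      E₁.C'.nodeVal x w' (E₁.C'.arg k₂ a) = D.nodeVal x w (D.arg G₂ a) := by
    intro a x w' w
    rw [harg₂]
    cases h : D.arg G₂ a with
    | const b => rfl
    | var i => rfl
    | gate g => exact absurd h (hng₂ a g)
  obtain ⟨σ, τ, hσ, hop₂⟩ := E₁.op_eq k₂
  have hσ0 : ∀ a, σ a = false := fun a => by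
    cases hs : σ a
    · rfl
    · obtain ⟨g, hg⟩ := hσ a hs; rw [hk₂] at hg; exact absurd hg (hng₂ a g)
  have hid₂' : ∀ (x : Fin n → Bool) (w' : Fin E₁.C'.m → Bool),
      E₁.C'.op k₂ (E₁.C'.nodeVal x w' (E₁.C'.arg k₂ 0)) (E₁.C'.nodeVal x w' (E₁.C'.arg k₂ 1)) = (c₂ ^^ τ) := by
    intro x w'
    rw [hop₂, hσ0, hσ0, Bool.xor_false, Bool.xor_false, hval₂ 0 x w' (fun _ => false),
      hval₂ 1 x w' (fun _ => false), hk₂, hid₂]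
  have hacc₂' : E₁.C'.arg k₂ 0 = E₁.C'.arg k₂ 1 ∨ ∃ (a : Fin 2) (b : Bool), E₁.C'.arg k₂ a = .const b := by
    rcases hacc₂ with h | ⟨a, b, h⟩
    · left; rw [harg₂, harg₂, h]
    · right; exact ⟨a, b, by rw [harg₂, h]; rfl⟩
  have hng₂' : ∀ a g, E₁.C'.arg k₂ a ≠ .gate g := by
    intro a g h
    rw [harg₂] at h
    cases h' : D.arg G₂ a with
    | const b => rw [h'] at h; cases h
    | var i => rw [h'] at h; cases h
    | gate g' => exact hng₂ a g' h'
  have hout₂ : E₁.C'.out ≠ .gate k₂ := out_ne_of_pointwise_const hf hd E₁.fair E₁.computes hid₂'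
  -- second elimination
  let E₂ := elimDataWRedirectConst (C := E₁.C') (k₀ := k₂) E₁.fair E₁.computes E₁.packing (c₂ ^^ τ) hid₂' hacc₂'
    (fun a => hng₂' a k₂) hout₂ hφ hI αQ
  -- the tracked variable
  have hrepl₁ : E₁.repl ≠ .var v := fun h => by cases h
  have hrepl₂ : E₂.repl ≠ .var v := fun h => by cases h
  have hf₁ := E₁.fanout_var_add hrepl₁
  have hf₂ := E₂.fanout_var_add hrepl₂
  have hcount₂ : (univ.filter fun a : Fin 2 => E₁.C'.arg k₂ a = .var v).card =
      (univ.filter fun a : Fin 2 => D.arg G₂ a = .var v).card := by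
    congr 1; ext a
    simp only [mem_filter, mem_univ, true_and]
    rw [E₁.arg_eq_var_iff, hk₂]
    constructor
    · rintro (h | ⟨h, -⟩)
      · exact h
      · exact absurd h (hng₂ a G₁)
    · exact fun h => Or.inl h
  have hfan : E₂.C'.fanout (.var v) = 0 := by
    rw [hcount₂] at hf₂
    omega
  -- influential inputs
  have hinf : ((E₂.C'.influential R).card : ℝ) + 1 ≤ (D.influential R).card := by
    have h1 : E₂.C'.influential R ⊆ (D.influential R).erase v := by
      intro i hi
      rw [mem_erase]
      refine ⟨?_, E₁.influential_subset R (E₂.influential_subset R hi)⟩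
      rintro rfl
      unfold influential at hi
      rw [mem_filter] at hi
      rcases hi.2 with h | h
      · rw [hfan] at h; exact absurd h (by norm_num)
      · exact hvp h
    have h2 := card_le_card h1
    rw [card_erase_of_mem hvinf] at h2
    have h3 := card_pos.mpr ⟨v, hvinf⟩
    have : (E₂.C'.influential R).card + 1 ≤ (D.influential R).card := by omega
    exact_mod_cast this
  -- assemble
  refine ⟨E₂.C', E₂.P', E₂.fair, E₂.computes, E₂.packing, ?_, ?_⟩
  · have h1 := E₁.m_add_one; have h2 := E₂.m_add_one; omega
  · have hpot : E₂.C'.potential E₂.P' ≤ D.potential P + 2 := by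
      have h1 := E₁.potential_le; have h2 := E₂.potential_le; linarith
    have hm : ((E₂.C'.m : ℕ) : ℝ) + 2 = D.m := by
      have h1 := E₁.m_add_one; have h2 := E₂.m_add_one
      have : E₂.C'.m + 2 = D.m := by omega
      exact_mod_cast this
    unfold measure
    nlinarith [mul_le_mul_of_nonneg_left hinf hI, mul_le_mul_of_nonneg_left hpot hφ]

end TwoConst

/-! ### Boolean bookkeeping for ∧-type gates -/

/-- The constant `c₁` at position `0`, resp. `c₂` at position `1`, trivializes
`((a ⊕ c₁) ∧ (b ⊕ c₂)) ⊕ c₃`. [cite: LiYang2022, §2.1] -/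
theorem liveFn_trivConst {D : Semicircuit n} {G : Fin D.m} {c₁ c₂ c₃ : Bool}
    (hop : ∀ a b, D.op G a b = (((a ^^ c₁) && (b ^^ c₂)) ^^ c₃)) (p : Fin 2) (t : Bool) :
    D.liveFn G p (if p = 0 then c₁ else c₂) t = c₃ := by
  unfold liveFn
  obtain rfl | rfl : p = 0 ∨ p = 1 := by fin_cases p <;> simp
  · rw [if_pos rfl, if_pos rfl, hop]; cases c₁ <;> cases c₂ <;> cases c₃ <;> cases t <;> rfl
  · rw [if_neg (by decide), if_neg (by decide), hop]; cases c₁ <;> cases c₂ <;> cases c₃ <;> cases t <;> rfl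

/-- Identifying the two wires of an ∧-type gate: `((u ⊕ b) ⊕ ·) ∧ (u ⊕ ·)` is constant for the
right `b` (Lemma 3.12, compact case: "an affine substitution `y ← x ⊕ b` will trivialize both
gates"). With the variable to be rewired at position `p`: `tz`/`tx` the trivializing constants of
the rewired/kept variable, `b = ¬(tx ⊕ tz)`. [cite: LiYang2022, Lemma 3.12] -/
theorem and_sameVar_const {D : Semicircuit n} {G : Fin D.m} {c₁ c₂ c₃ : Bool}
    (hop : ∀ a b, D.op G a b = (((a ^^ c₁) && (b ^^ c₂)) ^^ c₃)) (p : Fin 2) (t : Bool) :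
    (if p = 0 then D.op G (t ^^ !((if p = 0 then c₂ else c₁) ^^ (if p = 0 then c₁ else c₂))) t
      else D.op G t (t ^^ !((if p = 0 then c₂ else c₁) ^^ (if p = 0 then c₁ else c₂)))) = c₃ := by
  obtain rfl | rfl : p = 0 ∨ p = 1 := by fin_cases p <;> simp
  · simp only [if_true, hop]; cases c₁ <;> cases c₂ <;> cases c₃ <;> cases t <;> rfl
  · simp only [show (1 : Fin 2) ≠ 0 from by decide, if_false, hop]
    cases c₁ <;> cases c₂ <;> cases c₃ <;> cases t <;> rfl

/-- In `Fin 2` every point is `p` or `p.rev`. [folklore] -/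
theorem fin2_eq_or_eq_rev : ∀ (p a : Fin 2), a = p ∨ a = p.rev := by decide

section Pair

variable {C : Semicircuit n} {f : (Fin n → ZMod 2) → Bool} {R : RdqSource n} {d : ℕ}
  {αφ αI αQ : ℝ} {P : Finset (Fin C.m × Fin C.m)}

/-- A variable read by a gate of a circuit computing `f|_R` is free. [cite: LiYang2022, §2.3] -/
theorem free_of_reads (hC : C.ComputesRestr f R) {k : Fin C.m} {a : Fin 2} {j : Fin n} (h : C.arg k a = .var j) :
    R.Free j := by
  by_contra hnf
  exact (fanout_eq_zero_iff C _).mp (hC.1 j hnf) k a h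

/-- **The accounting of a constant substitution to an unprotected influential variable followed
by simplifications gaining `g`**: `Δμ ≥ α_I + g`, one substitution; enough as soon as
`δ ≤ α_I + g`. [cite: LiYang2022, §4.1, Lemma 3.12] -/
theorem stepBranch2_of_assignFree_gain (hφ : 0 ≤ αφ) (hI : 0 ≤ αI)
    {j : Fin n} (hj : R.Free j) (hjp : ¬ R.Protected j) (c : ZMod 2) (hP : C.IsPacking P)
    (hjinf : j ∈ C.influential R) (g : ℝ) (hδ : liYangDelta αφ αI αQ ≤ αI + g)
    {D' : Semicircuit n} {P' : Finset (Fin D'.m × Fin D'.m)} (hF' : D'.Fair)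
    (hC' : D'.ComputesRestr f (R.assignFree j c hj hjp)) (hP' : D'.IsPacking P')
    (hμ' : D'.measure αφ αI αQ P' (R.assignFree j c hj hjp) ≤
      (C.substConst j (finTwoEquiv c)).measure αφ αI αQ (C.substConstPacking j (finTwoEquiv c) P)
        (R.assignFree j c hj hjp) - g) :
    C.StepBranch2 f R αφ αI αQ P := by
  classical
  have hsub := measure_substConst_le hφ αI αQ hP R (R.assignFree j c hj hjp) j (finTwoEquiv c)
  have hinf : (((C.substConst j (finTwoEquiv c)).influential (R.assignFree j c hj hjp)).card : ℝ) + 1 ≤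
      (C.influential R).card := by
    have h1 := card_le_card (C.influential_substConst_assignFree_subset hj hjp c (finTwoEquiv c))
    have h3 := card_erase_of_mem hjinf
    have h4 := card_pos.mpr ⟨j, hjinf⟩
    have : ((C.substConst j (finTwoEquiv c)).influential (R.assignFree j c hj hjp)).card + 1 ≤
        (C.influential R).card := by omega
    exact_mod_cast this
  have hq : ((R.assignFree j c hj hjp).quadCount : ℝ) = R.quadCount := by
    rw [RdqSource.quadCount_assignFree]
  refine ⟨1, le_rfl, by norm_num, D', R.assignFree j c hj hjp, P', hF', hC', hP',
    RdqSource.dim_assignFree hj hjp, ?_⟩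
  simp only [Nat.cast_one, mul_one]
  rw [hq, sub_self, mul_zero, sub_zero] at hsub
  have h1 : αI ≤ αI * (((C.influential R).card : ℝ) -
      ((C.substConst j (finTwoEquiv c)).influential (R.assignFree j c hj hjp)).card) := by
    have h2 : (1 : ℝ) ≤ ((C.influential R).card : ℝ) -
        ((C.substConst j (finTwoEquiv c)).influential (R.assignFree j c hj hjp)).card := by linarith
    have := mul_le_mul_of_nonneg_left h2 hI
    rwa [mul_one] at this
  linarith

/-- **Troubled pair, a constant substitution trivializing both gates** (Lemma 3.12, compact
case, "a constant substitution (to `x` or `y`) … will trivialize both gates. We then replace `G₁`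
and `G₂` by constants such that `x` and `y` becomes non-influential. Hence `Δμ ≥ 2α_I`"): two
distinct gates read the unprotected variables `x_s` (at `p₁`, `p₂`) and `x_v` (at the other
positions), all wires of `x_v` go into them, and `x_s := b` trivializes both; one substitution,
`Δμ ≥ 2α_I + 2(1 - α_φ) ≥ δ`. [cite: LiYang2022, Lemma 3.12] -/
theorem pair_const (hf : IsAffineDisperser f d) (hd : 2 * d + 2 < R.dim) (hF : C.Fair)
    (hC : C.ComputesRestr f R) (hP : C.IsPacking P) (hφ : 0 ≤ αφ) (hφ1 : αφ ≤ 1) (hI : 0 ≤ αI) (αQ : ℝ)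
    {G₁ G₂ : Fin C.m} (hne : G₁ ≠ G₂) {s v : Fin n} (hsv : s ≠ v) {p₁ p₂ : Fin 2}
    (hs₁ : C.arg G₁ p₁ = .var s) (hv₁ : C.arg G₁ p₁.rev = .var v)
    (hs₂ : C.arg G₂ p₂ = .var s) (hv₂ : C.arg G₂ p₂.rev = .var v)
    (hfv : C.fanout (.var v) = 2) (hsp : ¬ R.Protected s) (hvp : ¬ R.Protected v)
    {b : Bool} (ht₁ : C.liveFn G₁ p₁ b false = C.liveFn G₁ p₁ b true)
    (ht₂ : C.liveFn G₂ p₂ b false = C.liveFn G₂ p₂ b true) :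
    C.StepBranch2 f R αφ αI αQ P := by
  classical
  have hs : R.Free s := free_of_reads hC hs₁
  have hsinf : s ∈ C.influential R := C.mem_influential_of_reads R hs₁
  let c : ZMod 2 := finTwoEquiv.symm b
  have hb : finTwoEquiv c = b := finTwoEquiv.apply_symm_apply b
  let C₁ := C.substConst s (finTwoEquiv c)
  let R₁ := R.assignFree s c hs hsp
  have hF₁ : C₁.Fair := hF.substConst s _
  have hC₁ : C₁.ComputesRestr f R₁ := hC.substConst_assignFree hs hsp c
  have hP₁ : C₁.IsPacking (C.substConstPacking s (finTwoEquiv c) P) := hP.substConst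
  have hd₁ : 2 * d ≤ R₁.dim := by
    have := RdqSource.dim_assignFree (b := c) hs hsp
    show 2 * d ≤ (R.assignFree s c hs hsp).dim; omega
  -- wires in `C₁`
  have hcs : ∀ {G : Fin C.m} {p : Fin 2}, C.arg G p = .var s → C₁.arg G p = .const b := by
    intro G p h; show (C.arg G p).substConst s (finTwoEquiv c) = _; rw [h, Node.substConst_var_self, hb]
  have hcv : ∀ {G : Fin C.m} {p : Fin 2}, C.arg G p = .var v → C₁.arg G p = .var v := by
    intro G p h; show (C.arg G p).substConst s (finTwoEquiv c) = _; rw [h, Node.substConst_var_of_ne hsv.symm]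
  have hng : ∀ {G : Fin C.m} {p : Fin 2}, C.arg G p = .var s → C.arg G p.rev = .var v → ∀ a g, C₁.arg G a ≠ .gate g := by
    intro G p hs' hv' a g
    rcases fin2_eq_or_eq_rev p a with rfl | rfl
    · rw [hcs hs']; exact fun h => by cases h
    · rw [hcv hv']; exact fun h => by cases h
  have hcount : ∀ {G : Fin C.m} {p : Fin 2}, C.arg G p = .var s → C.arg G p.rev = .var v →
      (univ.filter fun a : Fin 2 => C₁.arg G a = .var v).card = 1 := by
    intro G p hs' hv'
    refine card_filter_arg_eq_one (p := p.rev) (hcv hv') ?_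
    rw [Fin.rev_rev, hcs hs']; exact fun h => by cases h
  have hid : ∀ {G : Fin C.m} {p : Fin 2}, C.arg G p = .var s → C.liveFn G p b false = C.liveFn G p b true →
      ∀ (x : Fin n → Bool) (w : Fin C.m → Bool),
        C₁.op G (C₁.nodeVal x w (C₁.arg G 0)) (C₁.nodeVal x w (C₁.arg G 1)) = C.liveFn G p b false := by
    intro G p hs' ht x w
    exact op_eq_const_of_trivialized (D := C₁) (hcs hs') ht x w
  -- two eliminations, tracking `x_v`
  have hvinf₁ : v ∈ C₁.influential R₁ := C₁.mem_influential_of_reads R₁ (hcv hv₁)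
  have hvp₁ : ¬ R₁.Protected v := fun h => hvp ((RdqSource.protected_assignFree_iff hs hsp v).mp h)
  have hfv₁ : C₁.fanout (.var v) = (univ.filter fun a : Fin 2 => C₁.arg G₁ a = .var v).card +
      (univ.filter fun a : Fin 2 => C₁.arg G₂ a = .var v).card := by
    rw [hcount hs₁ hv₁, hcount hs₂ hv₂]
    show (C.substConst s (finTwoEquiv c)).fanout (.var v) = 1 + 1
    rw [C.fanout_substConst_var_of_ne s _ hsv.symm, hfv]
  obtain ⟨D', P', hF', hCD', hP', -, hμ'⟩ := elim_two_const_gates hf hd₁ hF₁ hC₁ hP₁ hφ hI αQ hne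
    _ _ (hid hs₁ ht₁) (Or.inr ⟨p₁, b, hcs hs₁⟩) (hng hs₁ hv₁) (hid hs₂ ht₂) (Or.inr ⟨p₂, b, hcs hs₂⟩)
    (hng hs₂ hv₂) hvp₁ hvinf₁ hfv₁
  refine stepBranch2_of_assignFree_gain hφ hI hs hsp c hP hsinf (2 * (1 - αφ) + αI) ?_ hF' hCD' hP' (by linarith)
  have := liYangDelta_le_four_thirds αφ αI αQ
  nlinarith

/-- **Troubled pair, the affine substitution** (Lemma 3.12, compact case: "an affine
substitution `y ← x ⊕ b` will trivialize both gates. We then replace `G₁` and `G₂` by constants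
such that `x` and `y` becomes non-influential"): two distinct gates read exactly the unprotected
`2`-variables `x` and `y`, and after rewiring `y` to `x ⊕ b` (`substVar`, `assignLin`) both
functions ignore their (coinciding) inputs; one substitution, `Δμ ≥ 2α_I + 2 - 3α_φ ≥ δ`.
[cite: LiYang2022, Lemma 3.12, Prop. 2.6] -/
theorem pair_affine (hf : IsAffineDisperser f d) (hd : 2 * d + 2 < R.dim) (hF : C.Fair)
    (hC : C.ComputesRestr f R) (hP : C.IsPacking P) (hφ : 0 ≤ αφ) (hφ1 : αφ ≤ 1 / 2) (hI : 0 ≤ αI) (αQ : ℝ)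
    {G₁ G₂ : Fin C.m} (hne : G₁ ≠ G₂) {x y : Fin n} (hxy : x ≠ y) {p₁ p₂ : Fin 2}
    (hx₁ : C.arg G₁ p₁ = .var x) (hy₁ : C.arg G₁ p₁.rev = .var y)
    (hx₂ : C.arg G₂ p₂ = .var x) (hy₂ : C.arg G₂ p₂.rev = .var y)
    (hfx : C.fanout (.var x) = 2) (hfy : C.fanout (.var y) = 2) (hxp : ¬ R.Protected x) (hyp : ¬ R.Protected y)
    {b : Bool} (c₁ c₂ : Bool)
    (hc₁ : ∀ t, (C.substVar y x b).op G₁ t t = c₁) (hc₂ : ∀ t, (C.substVar y x b).op G₂ t t = c₂) :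
    C.StepBranch2 f R αφ αI αQ P := by
  classical
  have hx : R.Free x := free_of_reads hC hx₁
  have hy : R.Free y := free_of_reads hC hy₁
  have hxinf : x ∈ C.influential R := C.mem_influential_of_reads R hx₁
  have hyinf : y ∈ C.influential R := C.mem_influential_of_reads R hy₁
  -- the source after `y := x ⊕ b`
  let c' : ZMod 2 := finTwoEquiv.symm b
  have hb : finTwoEquiv c' = b := finTwoEquiv.apply_symm_apply b
  let E : LinEq n := ⟨{x}, c'⟩
  have hE : ∀ i ∈ E.support, R.lin i = none ∧ i ≠ y := by
    intro i hi
    have : i = x := by simpa [E] using hi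
    subst this
    exact ⟨hx.1, hxy⟩
  let R₁ := R.assignLin y E hy hyp hE
  have hsol : ∀ v, v ∈ R₁.Sol ↔ v ∈ R.Sol ∧ v y = v x + c' := by
    intro v
    rw [RdqSource.mem_sol_assignLin_iff]
    have : E.eval v = v x + c' := by
      show c' + ∑ i ∈ ({x} : Finset (Fin n)), v i = _
      rw [sum_singleton, add_comm]
    rw [this]
  have hfree : ∀ i, R₁.Free i ↔ R.Free i ∧ i ≠ y := RdqSource.free_assignLin_iff hy hyp hE
  obtain ⟨g, hg⟩ := C.exists_out_eq_gate hf hF hC (by omega)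
  have hout : C.out ≠ .var y := by rw [hg]; exact fun h => by cases h
  -- the circuit after `y := x ⊕ b`
  let C₁ := C.substVar y x (finTwoEquiv c')
  have hF₁ : C₁.Fair := hF.substVar y x _
  have hC₁ : C₁.ComputesRestr f R₁ := hC.substVar hxy hsol hfree hx hout
  obtain ⟨P₁, hP₁, hpot₁⟩ := C.exists_packing_substVar y x (finTwoEquiv c') hxy hP
  have hd₁ : 2 * d ≤ R₁.dim := by
    have := RdqSource.dim_assignLin hy hyp hE
    show 2 * d ≤ (R.assignLin y E hy hyp hE).dim; omega
  -- wires in `C₁`: both positions read `x`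
  have hwx : ∀ {G : Fin C.m} {p : Fin 2}, C.arg G p = .var x → C.arg G p.rev = .var y → ∀ a, C₁.arg G a = .var x := by
    intro G p hx' hy' a
    show (C.arg G a).substVar y x = .var x
    rw [Node.substVar_eq_var_target_iff]
    rcases fin2_eq_or_eq_rev p a with rfl | rfl
    · exact Or.inr hx'
    · exact Or.inl hy'
  have hng : ∀ {G : Fin C.m} {p : Fin 2}, C.arg G p = .var x → C.arg G p.rev = .var y → ∀ a g', C₁.arg G a ≠ .gate g' := by
    intro G p hx' hy' a g' h; rw [hwx hx' hy'] at h; cases h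
  have hid : ∀ {G : Fin C.m} {p : Fin 2} {cc : Bool}, C.arg G p = .var x → C.arg G p.rev = .var y →
      (∀ t, (C.substVar y x b).op G t t = cc) →
      ∀ (xx : Fin n → Bool) (w : Fin C.m → Bool),
        C₁.op G (C₁.nodeVal xx w (C₁.arg G 0)) (C₁.nodeVal xx w (C₁.arg G 1)) = cc := by
    intro G p cc hx' hy' hcc xx w
    rw [hwx hx' hy' 0, hwx hx' hy' 1]
    show (C.substVar y x (finTwoEquiv c')).op G (xx x) (xx x) = cc
    rw [hb]
    exact hcc _
  -- two eliminations, tracking `x`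
  have hxp₁ : ¬ R₁.Protected x := fun h => hxp ((RdqSource.protected_assignLin_iff hy hyp hE x).mp h)
  have hxinf₁ : x ∈ C₁.influential R₁ := C₁.mem_influential_of_reads R₁ (hwx hx₁ hy₁ 0)
  have hfx₁ : C₁.fanout (.var x) = (univ.filter fun a : Fin 2 => C₁.arg G₁ a = .var x).card +
      (univ.filter fun a : Fin 2 => C₁.arg G₂ a = .var x).card := by
    rw [card_filter_arg_eq_two (hwx hx₁ hy₁), card_filter_arg_eq_two (hwx hx₂ hy₂)]
    show (C.substVar y x (finTwoEquiv c')).fanout (.var x) = 2 + 2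
    rw [C.fanout_substVar_var_target y x _ hxy, hfx, hfy]
  obtain ⟨D', P', hF', hCD', hP', hm', hμ'⟩ := elim_two_const_gates hf hd₁ hF₁ hC₁ hP₁ hφ hI αQ hne
    _ _ (hid hx₁ hy₁ hc₁) (Or.inl (by rw [hwx hx₁ hy₁, hwx hx₁ hy₁])) (hng hx₁ hy₁)
    (hid hx₂ hy₂ hc₂) (Or.inl (by rw [hwx hx₂ hy₂, hwx hx₂ hy₂])) (hng hx₂ hy₂) hxp₁ hxinf₁ hfx₁
  -- accounting: `μ(C₁) ≤ μ(C) - α_I + α_φ`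
  have hinf₁ : ((C₁.influential R₁).card : ℝ) + 1 ≤ (C.influential R).card := by
    have hfreej : ¬ R₁.Free y := fun h => ((hfree y).mp h).2 rfl
    have hprot : ∀ i, R₁.Protected i → R.Protected i := fun i h => (RdqSource.protected_assignLin_iff hy hyp hE i).mp h
    have h1 := C.influential_substVar_subset y x (finTwoEquiv c') hxy hfreej hprot
    have h2 : insert x ((C.influential R).erase y) = (C.influential R).erase y :=
      insert_eq_of_mem (mem_erase.mpr ⟨hxy, hxinf⟩)
    rw [h2] at h1
    have h3 := card_le_card h1
    change (C₁.influential R₁).card ≤ _ at h3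
    rw [card_erase_of_mem hyinf] at h3
    have h4 := card_pos.mpr ⟨y, hyinf⟩
    have : (C₁.influential R₁).card + 1 ≤ (C.influential R).card := by omega
    exact_mod_cast this
  have hq : (R₁.quadCount : ℝ) = R.quadCount := rfl
  have hμ₁ : C₁.measure αφ αI αQ P₁ R₁ ≤ C.measure αφ αI αQ P R - αI + αφ := by
    unfold measure
    rw [hq]
    show ((C.m : ℕ) : ℝ) + _ + _ + _ ≤ _
    nlinarith [mul_le_mul_of_nonneg_left hinf₁ hI, mul_le_mul_of_nonneg_left hpot₁ hφ]
  -- assemble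
  refine ⟨1, le_rfl, by norm_num, D', R₁, P', hF', hCD', hP', RdqSource.dim_assignLin hy hyp hE, ?_⟩
  have hδ := liYangDelta_le_four_thirds αφ αI αQ
  simp only [Nat.cast_one, mul_one]
  nlinarith

/-- **Troubled pair, non-compact case** (Lemma 3.12: "if `y` is unprotected, we perform
appropriate constant substitution to `x` and `z` such that both `G₁` and `G₂` are trivialized …
all three variables become non-influential, which leads to a total complexity measure decrement
`Δμ ≥ 3α_I`"): `G₁` reads `x, y`, `G₂` reads `z, y` (`x ≠ z`), `y` is a `2`-variable, all three
unprotected; two substitutions, `Δμ ≥ 3α_I + 2(1 - α_φ) ≥ 2δ`. [cite: LiYang2022, Lemma 3.12] -/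
theorem pair_noncompact (hf : IsAffineDisperser f d) (hd : 2 * d + 2 < R.dim) (hF : C.Fair)
    (hC : C.ComputesRestr f R) (hP : C.IsPacking P) (hφ : 0 ≤ αφ) (hφ1 : αφ ≤ 1) (hI : 0 ≤ αI) (αQ : ℝ)
    {G₁ G₂ : Fin C.m} (hne : G₁ ≠ G₂) {x y z : Fin n} (hxy : x ≠ y) (hyz : y ≠ z) (hxz : x ≠ z)
    {p₁ p₂ : Fin 2} (hx₁ : C.arg G₁ p₁ = .var x) (hy₁ : C.arg G₁ p₁.rev = .var y)
    (hz₂ : C.arg G₂ p₂ = .var z) (hy₂ : C.arg G₂ p₂.rev = .var y)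
    (hfy : C.fanout (.var y) = 2) (hxp : ¬ R.Protected x) (hyp : ¬ R.Protected y) (hzp : ¬ R.Protected z)
    {bx bz : Bool} (htx : C.liveFn G₁ p₁ bx false = C.liveFn G₁ p₁ bx true)
    (htz : C.liveFn G₂ p₂ bz false = C.liveFn G₂ p₂ bz true) :
    C.StepBranch2 f R αφ αI αQ P := by
  classical
  have hx : R.Free x := free_of_reads hC hx₁
  have hz : R.Free z := free_of_reads hC hz₂
  have hxinf : x ∈ C.influential R := C.mem_influential_of_reads R hx₁
  have hzinf : z ∈ C.influential R := C.mem_influential_of_reads R hz₂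
  let cx : ZMod 2 := finTwoEquiv.symm bx
  have hbx : finTwoEquiv cx = bx := finTwoEquiv.apply_symm_apply bx
  let cz : ZMod 2 := finTwoEquiv.symm bz
  have hbz : finTwoEquiv cz = bz := finTwoEquiv.apply_symm_apply bz
  -- the two substitutions
  let R₁ := R.assignFree x cx hx hxp
  have hz₁ : R₁.Free z := (RdqSource.free_assignFree_iff hx hxp z).mpr ⟨hz, hxz.symm⟩
  have hzp₁ : ¬ R₁.Protected z := fun h => hzp ((RdqSource.protected_assignFree_iff hx hxp z).mp h)
  let R₂ := R₁.assignFree z cz hz₁ hzp₁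
  let C₁ := C.substConst x (finTwoEquiv cx)
  let C₂ := C₁.substConst z (finTwoEquiv cz)
  have hF₂ : C₂.Fair := (hF.substConst x _).substConst z _
  have hC₁ : C₁.ComputesRestr f R₁ := hC.substConst_assignFree hx hxp cx
  have hC₂ : C₂.ComputesRestr f R₂ := hC₁.substConst_assignFree hz₁ hzp₁ cz
  have hP₁ : C₁.IsPacking (C.substConstPacking x (finTwoEquiv cx) P) := hP.substConst
  have hP₂ : C₂.IsPacking (C₁.substConstPacking z (finTwoEquiv cz) (C.substConstPacking x (finTwoEquiv cx) P)) :=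
    hP₁.substConst
  have hdim : R₂.dim + 2 = R.dim := by
    have h1 := RdqSource.dim_assignFree (b := cx) hx hxp
    have h2 := RdqSource.dim_assignFree (b := cz) hz₁ hzp₁
    change R₁.dim + 1 = R.dim at h1
    change R₂.dim + 1 = R₁.dim at h2
    omega
  have hd₂ : 2 * d ≤ R₂.dim := by omega
  -- wires in `C₂`
  have harg₂ : ∀ G a, C₂.arg G a = ((C.arg G a).substConst x (finTwoEquiv cx)).substConst z (finTwoEquiv cz) :=
    fun _ _ => rfl
  have hGx : C₂.arg G₁ p₁ = .const bx := by
    rw [harg₂, hx₁, Node.substConst_var_self, hbx]; rfl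
  have hGy₁ : C₂.arg G₁ p₁.rev = .var y := by
    rw [harg₂, hy₁, Node.substConst_var_of_ne hxy.symm, Node.substConst_var_of_ne hyz]
  have hGz : C₂.arg G₂ p₂ = .const bz := by
    rw [harg₂, hz₂, Node.substConst_var_of_ne hxz.symm, Node.substConst_var_self, hbz]
  have hGy₂ : C₂.arg G₂ p₂.rev = .var y := by
    rw [harg₂, hy₂, Node.substConst_var_of_ne hxy.symm, Node.substConst_var_of_ne hyz]
  have hng : ∀ {G : Fin C.m} {p : Fin 2} {bb : Bool}, C₂.arg G p = .const bb → C₂.arg G p.rev = .var y →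
      ∀ a g, C₂.arg G a ≠ .gate g := by
    intro G p bb h1 h2 a g
    rcases fin2_eq_or_eq_rev p a with rfl | rfl
    · rw [h1]; exact fun h => by cases h
    · rw [h2]; exact fun h => by cases h
  have hcount : ∀ {G : Fin C.m} {p : Fin 2} {bb : Bool}, C₂.arg G p = .const bb → C₂.arg G p.rev = .var y →
      (univ.filter fun a : Fin 2 => C₂.arg G a = .var y).card = 1 := by
    intro G p bb h1 h2
    refine card_filter_arg_eq_one (p := p.rev) h2 ?_
    rw [Fin.rev_rev, h1]; exact fun h => by cases h
  have htx₂ : C₂.liveFn G₁ p₁ bx false = C₂.liveFn G₁ p₁ bx true := htx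
  have htz₂ : C₂.liveFn G₂ p₂ bz false = C₂.liveFn G₂ p₂ bz true := htz
  -- two eliminations, tracking `y`
  have hyp₂ : ¬ R₂.Protected y := fun h =>
    hyp ((RdqSource.protected_assignFree_iff hx hxp y).mp ((RdqSource.protected_assignFree_iff hz₁ hzp₁ y).mp h))
  have hyinf₂ : y ∈ C₂.influential R₂ := C₂.mem_influential_of_reads R₂ hGy₁
  have hfy₂ : C₂.fanout (.var y) = (univ.filter fun a : Fin 2 => C₂.arg G₁ a = .var y).card +
      (univ.filter fun a : Fin 2 => C₂.arg G₂ a = .var y).card := by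
    rw [hcount hGx hGy₁, hcount hGz hGy₂]
    show (C₁.substConst z (finTwoEquiv cz)).fanout (.var y) = 1 + 1
    rw [C₁.fanout_substConst_var_of_ne z _ hyz]
    show (C.substConst x (finTwoEquiv cx)).fanout (.var y) = 1 + 1
    rw [C.fanout_substConst_var_of_ne x _ hxy.symm, hfy]
  obtain ⟨D', P', hF', hCD', hP', -, hμ'⟩ := elim_two_const_gates hf hd₂ hF₂ hC₂ hP₂ hφ hI αQ hne
    _ _ (op_eq_const_of_trivialized hGx htx₂) (Or.inr ⟨p₁, bx, hGx⟩) (hng hGx hGy₁)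
    (op_eq_const_of_trivialized hGz htz₂) (Or.inr ⟨p₂, bz, hGz⟩) (hng hGz hGy₂) hyp₂ hyinf₂ hfy₂
  -- accounting: `μ(C₂) ≤ μ(C) - 2α_I`
  have hsub₁ := measure_substConst_le hφ αI αQ hP R R₁ x (finTwoEquiv cx)
  have hsub₂ := measure_substConst_le hφ αI αQ hP₁ R₁ R₂ z (finTwoEquiv cz)
  have hq₁ : (R₁.quadCount : ℝ) = R.quadCount := by
    show ((R.assignFree x cx hx hxp).quadCount : ℝ) = _; rw [RdqSource.quadCount_assignFree]
  have hq₂ : (R₂.quadCount : ℝ) = R₁.quadCount := by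
    show ((R₁.assignFree z cz hz₁ hzp₁).quadCount : ℝ) = _; rw [RdqSource.quadCount_assignFree]
  have hinf₂ : ((C₂.influential R₂).card : ℝ) + 2 ≤ (C.influential R).card := by
    have h1 := C.influential_substConst_assignFree_subset hx hxp cx (finTwoEquiv cx)
    have h2 := C₁.influential_substConst_assignFree_subset hz₁ hzp₁ cz (finTwoEquiv cz)
    have h3 : C₂.influential R₂ ⊆ ((C.influential R).erase x).erase z :=
      h2.trans (erase_subset_erase _ h1)
    have h4 := card_le_card h3
    have hzmem : z ∈ (C.influential R).erase x := mem_erase.mpr ⟨hxz.symm, hzinf⟩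
    rw [card_erase_of_mem hzmem, card_erase_of_mem hxinf] at h4
    have h5 := card_pos.mpr ⟨x, hxinf⟩
    have h6 : 1 < (C.influential R).card := by
      have := card_pos.mpr ⟨z, hzmem⟩; rw [card_erase_of_mem hxinf] at this; omega
    have : (C₂.influential R₂).card + 2 ≤ (C.influential R).card := by omega
    exact_mod_cast this
  -- assemble
  refine ⟨2, by norm_num, by norm_num, D', R₂, P', hF', hCD', hP', hdim, ?_⟩
  have hδ := liYangDelta_le_four_thirds αφ αI αQ
  push_cast
  rw [hq₁, sub_self, mul_zero, sub_zero] at hsub₁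
  rw [hq₂, sub_self, mul_zero, sub_zero] at hsub₂
  nlinarith [mul_le_mul_of_nonneg_left hinf₂ hI]

/-- The compensated function of a gate after `substVar z x b`, when it reads `x_z` at `p` and
`x_x ≠ x_z` at the other position, on coinciding inputs. [folklore] -/
theorem substVar_op_self {G : Fin C.m} {x z : Fin n} (hxz : x ≠ z) {p : Fin 2} (hz : C.arg G p = .var z)
    (hx : C.arg G p.rev = .var x) (b t : Bool) :
    (C.substVar z x b).op G t t = if p = 0 then C.op G (t ^^ b) t else C.op G t (t ^^ b) := by
  show C.op G (t ^^ (b && decide (C.arg G 0 = .var z))) (t ^^ (b && decide (C.arg G 1 = .var z))) = _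
  have hxz' : (Node.var x : Node n C.m) ≠ .var z := fun h => hxz (Node.var.inj h)
  obtain rfl | rfl : p = 0 ∨ p = 1 := by fin_cases p <;> simp
  · have hr : (0 : Fin 2).rev = 1 := rfl
    rw [hr] at hx
    rw [if_pos rfl, hz, decide_eq_true rfl, Bool.and_true, hx, decide_eq_false hxz', Bool.and_false, Bool.xor_false]
  · have hr : (1 : Fin 2).rev = 0 := rfl
    rw [hr] at hx
    rw [if_neg (by decide), hz, decide_eq_true rfl, Bool.and_true, hx, decide_eq_false hxz', Bool.and_false,
      Bool.xor_false]

/-- **Troubled pair elimination** (Li–Yang Lemma 3.12, in the form used by Case 0.4 of the proof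
of Thm. 4.1): in a fair semicircuit computing `f|_R` (`f` an affine disperser for dimension `d`,
`dim R > 2d + 2`) with a packing, two distinct adjacent troubled gates allow `1 ≤ t ≤ 2`
substitutions with `Δμ ≥ δ t`: a protected variable of the pair is Case 1; otherwise a
non-compact pair takes two constant substitutions (`Δμ ≥ 3α_I`), a compact pair one constant or
one affine substitution (`Δμ ≥ 2α_I`). [cite: LiYang2022, Lemma 3.12, §4.1 (Case 0.4)] -/
theorem troubledPair (hf : IsAffineDisperser f d) (hd : 2 * d + 2 < R.dim) (hF : C.Fair)
    (hC : C.ComputesRestr f R) (hP : C.IsPacking P) (hφ : 0 ≤ αφ) (hφ1 : αφ ≤ 1 / 2) (hI : 0 ≤ αI) (αQ : ℝ)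
    {G₁ G₂ : Fin C.m} (hne : G₁ ≠ G₂) (hT₁ : C.Troubled G₁) (hT₂ : C.Troubled G₂) (hadj : C.Adjacent G₁ G₂) :
    C.StepBranch2 f R αφ αI αQ P := by
  classical
  obtain ⟨z, hz₁, hz₂⟩ := hadj
  obtain ⟨p₁, x, hxz, hGz₁, hGx₁, hfz, hfx⟩ := hT₁.exists_wires_of_reads hz₁
  obtain ⟨p₂, w, hwz, hGz₂, hGw₂, -, hfw⟩ := hT₂.exists_wires_of_reads hz₂
  obtain ⟨hand₁, h1₁, -⟩ := hT₁.exists_wires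
  obtain ⟨hand₂, h1₂, -⟩ := hT₂.exists_wires
  have hread₁ : ∃ (Q : Fin C.m) (a : Fin 2), C.arg Q a = .gate G₁ := exists_reader_of_fanout_pos (by omega)
  have hread₂ : ∃ (Q : Fin C.m) (a : Fin 2), C.arg Q a = .gate G₂ := exists_reader_of_fanout_pos (by omega)
  -- a protected variable: Case 1
  by_cases hzP : R.Protected z
  · obtain ⟨-, l, e, he, hr⟩ := hzP
    exact case1_and_gate hf hd hF hC hP hφ hI αQ he hr hGz₁ hand₁ hread₁
  by_cases hxP : R.Protected x
  · obtain ⟨-, l, e, he, hr⟩ := hxP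
    exact case1_and_gate hf hd hF hC hP hφ hI αQ he hr hGx₁ hand₁ hread₁
  by_cases hwP : R.Protected w
  · obtain ⟨-, l, e, he, hr⟩ := hwP
    exact case1_and_gate hf hd hF hC hP hφ hI αQ he hr hGw₂ hand₂ hread₂
  by_cases hwx : w = x
  · -- compact pair: both gates read `x` and `z`
    subst hwx
    obtain ⟨α₁, β₁, γ₁, hop₁⟩ := hand₁
    obtain ⟨α₂, β₂, γ₂, hop₂⟩ := hand₂
    -- trivializing constants of `z` and `x` in each gate
    let tz₁ : Bool := if p₁ = 0 then α₁ else β₁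
    let tx₁ : Bool := if p₁ = 0 then β₁ else α₁
    let tz₂ : Bool := if p₂ = 0 then α₂ else β₂
    let tx₂ : Bool := if p₂ = 0 then β₂ else α₂
    have htz₁ : ∀ t, C.liveFn G₁ p₁ tz₁ t = γ₁ := liveFn_trivConst hop₁ p₁
    have htz₂ : ∀ t, C.liveFn G₂ p₂ tz₂ t = γ₂ := liveFn_trivConst hop₂ p₂
    have hrev : ∀ (p : Fin 2) (u v : Bool), (if p.rev = 0 then u else v) = if p = 0 then v else u := by decide
    have htx₁ : ∀ t, C.liveFn G₁ p₁.rev tx₁ t = γ₁ := fun t => by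
      have := liveFn_trivConst hop₁ p₁.rev t; rwa [hrev] at this
    have htx₂ : ∀ t, C.liveFn G₂ p₂.rev tx₂ t = γ₂ := fun t => by
      have := liveFn_trivConst hop₂ p₂.rev t; rwa [hrev] at this
    by_cases hz12 : tz₁ = tz₂
    · -- `z := tz₁` trivializes both
      refine pair_const hf hd hF hC hP hφ (by linarith) hI αQ hne hxz.symm hGz₁ hGx₁ hGz₂ hGw₂ hfx hzP hxP
        (b := tz₁) (by rw [htz₁, htz₁]) ?_
      rw [hz12, htz₂, htz₂]
    by_cases hx12 : tx₁ = tx₂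
    · -- `x := tx₁` trivializes both
      have hGz₁' : C.arg G₁ p₁.rev.rev = .var z := by rw [Fin.rev_rev]; exact hGz₁
      have hGz₂' : C.arg G₂ p₂.rev.rev = .var z := by rw [Fin.rev_rev]; exact hGz₂
      refine pair_const hf hd hF hC hP hφ (by linarith) hI αQ hne hxz hGx₁ hGz₁' hGw₂ hGz₂' hfz hxP hzP
        (b := tx₁) (by rw [htx₁, htx₁]) ?_
      rw [hx12, htx₂, htx₂]
    · -- the affine substitution `z := x ⊕ b`
      let b : Bool := !(tx₁ ^^ tz₁)
      have hb₂ : (!(tx₂ ^^ tz₂)) = b := by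
        have h1 : tz₂ = !tz₁ := by
          revert hz12; cases tz₁ <;> cases tz₂ <;> simp
        have h2 : tx₂ = !tx₁ := by
          revert hx12; cases tx₁ <;> cases tx₂ <;> simp
        show (!(tx₂ ^^ tz₂)) = !(tx₁ ^^ tz₁)
        rw [h1, h2]; cases tx₁ <;> cases tz₁ <;> rfl
      have hGz₁' : C.arg G₁ p₁.rev.rev = .var z := by rw [Fin.rev_rev]; exact hGz₁
      have hGz₂' : C.arg G₂ p₂.rev.rev = .var z := by rw [Fin.rev_rev]; exact hGz₂
      refine pair_affine hf hd hF hC hP hφ hφ1 hI αQ hne hxz hGx₁ hGz₁' hGw₂ hGz₂' hfx hfz hxP hzP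
        (b := b) γ₁ γ₂ (fun t => ?_) (fun t => ?_)
      · rw [C.substVar_op_self hxz hGz₁ hGx₁]
        exact and_sameVar_const hop₁ p₁ t
      · rw [C.substVar_op_self hxz hGz₂ hGw₂, ← hb₂]
        exact and_sameVar_const hop₂ p₂ t
  · -- non-compact pair: boundary variables `x` (of `G₁`) and `w` (of `G₂`), inner variable `z`
    obtain ⟨bx, hbx⟩ := exists_trivializing hand₁ p₁.rev
    obtain ⟨bw, hbw⟩ := exists_trivializing hand₂ p₂.rev
    have hGz₁' : C.arg G₁ p₁.rev.rev = .var z := by rw [Fin.rev_rev]; exact hGz₁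
    have hGz₂' : C.arg G₂ p₂.rev.rev = .var z := by rw [Fin.rev_rev]; exact hGz₂
    exact pair_noncompact hf hd hF hC hP hφ (by linarith) hI αQ hne hxz hwz.symm (fun h => hwx h.symm)
      hGx₁ hGz₁' hGw₂ hGz₂' hfz hxP hzP hwP hbx hbw

end Pair

end Semicircuit

end Literature.Computability.Complexity
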